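import Mathlib
import Literature.AlgebraicGeometry.Resolution.LocalBlowup
import Literature.AlgebraicGeometry.Resolution.LocalUniformization
import Literature.AlgebraicGeometry.Resolution.RankOneReductionProofs
import Summits.ResolutionOfSingularities.ResolutionOfSingularities.Theorems.HomologicalConductorStrictDropTowerShape
import Summits.ResolutionOfSingularities.ResolutionOfSingularities.Theorems.HomologicalConductorNoZenoTowerNoetherian
import Summits.ResolutionOfSingularities.ResolutionOfSingularities.Theorems.HomologicalConductorNoZenoDim2RegularCentre
import Summits.ResolutionOfSingularities.ResolutionOfSingularities.Theorems.FrobeniusClosingSteerTowerHeight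
import HarnessLib

/-!
# Crux `StrictDrop` (stmt-ResolutionOfSingularities-16485), line `birth` — the Krull dimension is NON-INCREASING and
# EVENTUALLY CONSTANT along the canonical tower

Route `ResolutionOfSingularities/HomologicalConductor`, crux #4 `StrictDrop` (registered skeleton
`Cruxes/StrictDrop/Lines/birth.lean`, v4, sha16 `0bb865f43b01e4a8`), canonical normalised `ca`-tower
`T₀ = loc A`, `T_(m+1) = loc (nrm (chart T_m))` of a finitely generated `A ⊆ O ⊆ K = Frac A` along a valuation
ring `O` (Birth vocabulary `NoZeno.Birth.tower`, definitionally the route's `let tower`).  OURS (cell decomp-res,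
hand leafhand-res-homologicalconduct-3; the dimension lemma is the «cheap true item» named in the crux's
`KERNEL.md` v2 §Recommendation, 2026-08-17); AI-written support lemmas, weaker than expert review; nothing here is a
statement of any manuscript under review.  SUPPORT-level: helper lemmas for ONE leaf; neither the crux, nor the
route, nor resolution of singularities in positive characteristic is proved here.

## Content (all proved, def-free, fact-free)

* `NoZeno.Birth.exists_fg_model_tower` — every stage is, as a subring, `(A_m)_{𝔪_O ∩ A_m}` for a finitely
  generated `A ≤ A_m ⊆ O` (the route's landed `HomologicalConductorGlobalisation.stub_towerModel`, read in Birth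
  vocabulary).
* `NoZeno.Birth.ringKrullDim_tower_eq_height_centre` — `dim T_m = ht (𝔪_O ∩ A_m)` for any such model.
* **`NoZeno.Birth.ringKrullDim_tower_le_of_le`** — `m ≤ n ⇒ dim T_n ≤ dim T_m`.  Proof: `C := A_m ⊔ A_n` is a
  finitely generated model of `T_n` as well (`A_m ≤ T_m ≤ T_n`, and localising at the centre is idempotent), so
  both dimensions are heights of centres, and along the finitely generated extension `A_m ≤ C` inside the common
  fraction field `K` (transcendence degree `0`) the height of the centre cannot grow — Matsumura's dimension
  inequality, in the tree as `SwitchingDichotomy.TowerHeight.height_comap_le_of_isAlgebraic`.  (Geometrically: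
  `T_n` dominates `T_m`, the residue field can only gain transcendence degree, `dim = tr.deg K − tr.deg κ`.)
* `NoZeno.Birth.exists_ringKrullDim_tower_eq_nat`, **`NoZeno.Birth.exists_ringKrullDim_tower_eventually_eq`** —
  the dimensions are natural numbers `≤ tr.deg_k K`, hence EVENTUALLY CONSTANT: some `e ≤ tr.deg_k K` and `m₀`
  with `dim T_n = e` for all `n ≥ m₀`.  Use: the open kernel `stub_dichotomy_dimGETwo` of this crux (drop or
  freeze from a stage all of whose successors are singular of dimension `≥ 2`; ≡ the crux,
  `HomologicalConductorStrictDropKernelIff`) splits by the terminal dimension `e ≥ 2` of the run, the case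
  `e = 2` being the regime of the kill test `SurfaceTermination` after re-grounding over a transcendence basis
  of the residue field — a reshape for the planner, not performed here.

References (mechanism only): H. Matsumura, *Commutative Ring Theory*, Thm. 15.5, §5 [`Matsumura1987`].
-/

noncomputable section

-- single-problem summit: the doubled namespace component `ResolutionOfSingularities` is forced
set_option linter.dupNamespace false

open IsLocalRing
open Literature.AlgebraicGeometry.Resolution
open Summit.ResolutionOfSingularities.ResolutionOfSingularities.Theorems.HomologicalConductorGlobalisation
  (stub_locEq stub_chartStep stub_nrmStep stub_towerModel)
open Summit.ResolutionOfSingularities.ResolutionOfSingularities.Theorems.SwitchingDichotomy (TowerHeight.height_comap_le_of_isAlgebraic)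

namespace Summit.ResolutionOfSingularities.ResolutionOfSingularities.Theorems.NoZeno.Birth

variable {k K : Type} [Field k] [Field K] [Algebra k K]

/-- **Finitely generated models of the stages** (Birth vocabulary): every stage `T_m` of the canonical
normalised `ca`-tower is, as a subring of `K`, the localisation at the centre of `O` of a finitely generated
`k`-subalgebra `A ≤ A_m ⊆ O` (the route's landed `stub_towerModel`, read through the definitional bridge
`NoZeno.Birth.tower = the route's let-bound tower`). [folklore] -/
theorem exists_fg_model_tower (O : ValuationSubring K) (A : Subalgebra k K) (hA : A.FG)
    (hfr : IsFractionRing ↥A K) (hAO : A.toSubring ≤ O.toSubring) (m : ℕ) :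
    ∃ Am : Subalgebra k K, Am.FG ∧ A ≤ Am ∧ Am.toSubring ≤ O.toSubring ∧
      (tower O A m).toSubring = locAtCentre Am.toSubring O :=
  stub_towerModel stub_locEq stub_chartStep stub_nrmStep O A hA hfr hAO m


/-- **The Krull dimension of a stage is the height of the centre of `O` on any of its finitely generated
models**: if `(T_m).toSubring = (A_m)_{𝔪_O ∩ A_m}` then `dim T_m = ht (𝔪_O ∩ A_m)` (dimension of the
localisation at a prime). [cite: Matsumura1987, §5 p. 30] [folklore] -/
theorem ringKrullDim_tower_eq_height_centre (O : ValuationSubring K) (A : Subalgebra k K) (m : ℕ)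
    {Am : Subalgebra k K} (hAmO : Am.toSubring ≤ O.toSubring)
    (hT : (tower O A m).toSubring = locAtCentre Am.toSubring O) :
    ringKrullDim ↥(tower O A m) = (subringCentre Am.toSubring O hAmO).height := by
  have h1 : ringKrullDim ↥(tower O A m) = ringKrullDim ↥(locAtCentre Am.toSubring O) :=
    ringKrullDim_eq_of_ringEquiv (RingEquiv.subringCongr hT)
  haveI := isLocalization_locAtCentre (B := Am.toSubring) (O := O) hAmO
  rw [h1, IsLocalization.AtPrime.ringKrullDim_eq_height (subringCentre Am.toSubring O hAmO)
    (locAtCentre Am.toSubring O)]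

/-- **The Krull dimension is NON-INCREASING along the canonical tower**: `m ≤ n ⇒ dim T_n ≤ dim T_m`.
Proof: finitely generated models `A_m`, `A_n` of the two stages (`exists_fg_model_tower`); the finitely
generated `C := A_m ⊔ A_n` lies in `T_n` (the tower increases), so `T_n` is ALSO the localisation of `C` at the
centre of `O` (`(A_n)_𝔭 ⊆ C_𝔭 ⊆ (T_n)_𝔭 = T_n`); both dimensions are heights of centres
(`ringKrullDim_tower_eq_height_centre`), and along the finitely generated, algebraic (same fraction field `K`)
extension `A_m ≤ C` the height of the centre cannot grow — Matsumura's dimension inequality with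
`tr.deg_{A_m} C = 0` (tree: `TowerHeight.height_comap_le_of_isAlgebraic`). Geometrically: `T_n` dominates
`T_m`, so the residue transcendence degree over `k` can only grow and `dim = tr.deg_k K − tr.deg_k κ` can only
drop. [cite: Matsumura1987, Thm. 15.5] [folklore] -/
theorem ringKrullDim_tower_le_of_le (O : ValuationSubring K) (A : Subalgebra k K) (hA : A.FG)
    (hfr : IsFractionRing ↥A K) (hAO : A.toSubring ≤ O.toSubring) {m n : ℕ} (hmn : m ≤ n) :
    ringKrullDim ↥(tower O A n) ≤ ringKrullDim ↥(tower O A m) := by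
  haveI := hfr
  obtain ⟨Am, hAmfg, hAAm, hAmO, hTm⟩ := exists_fg_model_tower O A hA hfr hAO m
  obtain ⟨An, hAnfg, -, hAnO, hTn⟩ := exists_fg_model_tower O A hA hfr hAO n
  -- the models lie inside their stages
  have hAmT : Am ≤ tower O A m := fun x hx => by
    have h : x ∈ locAtCentre Am.toSubring O := le_locAtCentre Am.toSubring O hx
    rw [← hTm] at h
    exact h
  have hAnT : An ≤ tower O A n := fun x hx => by
    have h : x ∈ locAtCentre An.toSubring O := le_locAtCentre An.toSubring O hx
    rw [← hTn] at h
    exact h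
  -- the common finitely generated model `C = Am ⊔ An ≤ T_n`
  have hCfg : (Am ⊔ An).FG := hAmfg.sup hAnfg
  have hAmC : Am ≤ Am ⊔ An := le_sup_left
  have hAnC : An ≤ Am ⊔ An := le_sup_right
  have hCT : Am ⊔ An ≤ tower O A n :=
    sup_le (hAmT.trans fun x hx => d2rc_mem_tower_of_le O A hmn hx) hAnT
  have hTnO : (tower O A n).toSubring ≤ O.toSubring := by
    rw [hTn]
    exact locAtCentre_le hAnO
  have hCO : (Am ⊔ An).toSubring ≤ O.toSubring := fun x hx => hTnO (hCT hx)
  -- `T_n` is also the localisation of `C` at the centre of `O`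
  have hTnC : (tower O A n).toSubring = locAtCentre (Am ⊔ An).toSubring O := by
    apply le_antisymm
    · rw [hTn]
      exact locAtCentre_mono O (show An.toSubring ≤ (Am ⊔ An).toSubring from fun x hx => hAnC hx)
    · calc locAtCentre (Am ⊔ An).toSubring O ≤ locAtCentre (tower O A n).toSubring O :=
            locAtCentre_mono O (fun x hx => hCT hx)
        _ = (tower O A n).toSubring := by rw [hTn, locAtCentre_locAtCentre]
  -- both dimensions are heights of centres
  rw [ringKrullDim_tower_eq_height_centre O A n hCO hTnC,
    ringKrullDim_tower_eq_height_centre O A m hAmO hTm]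
  -- the dimension inequality along the algebraic finitely generated extension `Am ≤ C`
  have halg : Algebra.IsAlgebraic ↥Am K := by
    haveI : IsFractionRing ↥Am K := isFractionRing_subalgebra_of_le A Am hAAm
    exact IsLocalization.isAlgebraic K (nonZeroDivisors ↥Am)
  have hQ := TowerHeight.height_comap_le_of_isAlgebraic Am (Am ⊔ An) hAmC hAmfg hCfg halg
    (centreIdeal (Am ⊔ An) O hCO)
  have hcomap : (centreIdeal (Am ⊔ An) O hCO).comap (Subalgebra.inclusion hAmC).toRingHom =
      centreIdeal Am O hAmO := by
    ext x
    simp only [Ideal.mem_comap, centreIdeal, AlgHom.toRingHom_eq_coe, RingHom.coe_coe]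
    rfl
  rw [hcomap] at hQ
  -- `centreIdeal` and `subringCentre` are the same ideal (`rfl`)
  change ((centreIdeal (Am ⊔ An) O hCO).height : WithBot ℕ∞) ≤ (centreIdeal Am O hAmO).height
  exact_mod_cast hQ


/-- Every stage has a natural-number Krull dimension, bounded by `tr.deg_k K` (the stages are non-trivial
subrings of `K` of dimension `≤ tr.deg_k K < ∞`, `d2rc_ringKrullDim_tower_le`). [cite: Matsumura1987, Thm. 5.6] [folklore] -/
theorem exists_ringKrullDim_tower_eq_nat (O : ValuationSubring K) (A : Subalgebra k K) (hA : A.FG)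
    (hfr : IsFractionRing ↥A K) (m : ℕ) :
    ∃ e : ℕ, ringKrullDim ↥(tower O A m) = e ∧ (e : ℕ∞) ≤ Cardinal.toNat (Algebra.trdeg k K) := by
  haveI := hfr
  haveI : Algebra.FiniteType k ↥A := A.fg_iff_finiteType.mp hA
  obtain ⟨d, -, hdtr⟩ := exists_ringKrullDim_eq_and_trdeg_eq k ↥A
  have htr : Algebra.trdeg k K = d := by rw [trdeg_eq_trdeg_of_isFractionRing A, hdtr]
  have hle : ringKrullDim ↥(tower O A m) ≤ d := d2rc_ringKrullDim_tower_le O A m htr.le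
  have hnn : (0 : WithBot ℕ∞) ≤ ringKrullDim ↥(tower O A m) := ringKrullDim_nonneg_of_nontrivial
  have htoNat : Cardinal.toNat (Algebra.trdeg k K) = d := by rw [htr]; simp
  rw [htoNat]
  -- a Krull dimension squeezed between `0` and `d` is a natural number `≤ d`
  generalize hx : ringKrullDim ↥(tower O A m) = x at hle hnn
  induction x using WithBot.recBotCoe with
  | bot => exact absurd hnn (by simp)
  | coe x =>
    induction x using ENat.recTopCoe with
    | top =>
      exfalso
      have h : ((⊤ : ℕ∞) : WithBot ℕ∞) ≤ ((d : ℕ∞) : WithBot ℕ∞) := hle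
      exact ENat.coe_ne_top d (top_le_iff.mp (WithBot.coe_le_coe.mp h))
    | coe e =>
      refine ⟨e, rfl, ?_⟩
      have h : ((e : ℕ∞) : WithBot ℕ∞) ≤ ((d : ℕ∞) : WithBot ℕ∞) := hle
      exact WithBot.coe_le_coe.mp h

/-- **The Krull dimension is EVENTUALLY CONSTANT along the canonical tower**: there are a stage `m₀` and a
natural number `e ≤ tr.deg_k K` with `dim T_n = e` for every `n ≥ m₀` (a non-increasing sequence of natural
numbers stabilises). In particular an infinite run of stages of dimension `≥ 2` — the regime of the registered
kernel `stub_dichotomy_dimGETwo` of crux `StrictDrop` — has a well-defined terminal dimension `e ≥ 2`, along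
which the kernel splits case by case. [folklore] -/
theorem exists_ringKrullDim_tower_eventually_eq (O : ValuationSubring K) (A : Subalgebra k K) (hA : A.FG)
    (hfr : IsFractionRing ↥A K) (hAO : A.toSubring ≤ O.toSubring) :
    ∃ m₀ e : ℕ, (e : ℕ∞) ≤ Cardinal.toNat (Algebra.trdeg k K) ∧
      ∀ n : ℕ, m₀ ≤ n → ringKrullDim ↥(tower O A n) = e := by
  classical
  choose e he hetr using fun m => exists_ringKrullDim_tower_eq_nat O A hA hfr m
  -- `e` is non-increasing
  have hanti : ∀ {m n : ℕ}, m ≤ n → e n ≤ e m := by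
    intro m n hmn
    have h := ringKrullDim_tower_le_of_le O A hA hfr hAO hmn
    rw [he n, he m] at h
    exact_mod_cast h
  -- a minimal value of `e` is attained at some `m₀`, and `e` is constant from there on
  have hex : ∃ v : ℕ, ∃ m : ℕ, e m = v := ⟨e 0, 0, rfl⟩
  obtain ⟨m₀, hm₀⟩ := (Nat.find_spec hex : ∃ m : ℕ, e m = Nat.find hex)
  refine ⟨m₀, e m₀, hetr m₀, fun n hn => ?_⟩
  rw [he n]
  have h1 : e n ≤ e m₀ := hanti hn
  have h2 : e m₀ ≤ e n := by
    rw [hm₀]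
    exact Nat.find_min' hex ⟨n, rfl⟩
  exact_mod_cast le_antisymm h1 h2

end Summit.ResolutionOfSingularities.ResolutionOfSingularities.Theorems.NoZeno.Birth


end
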